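import Summits.CriticalPhenomena.PercolationContinuityZ3.Theorems.PercNearOneGluingNoHeavyLowerTailSunflowerTriangleEdgeReduction
import HarnessLib

/-!
# `NoHeavyLowerTail` (crux stmt-CriticalPhenomena-4575), abstract sunflower cubic: STRUCTURED two-point certificate no. 2 —
# ★-REDUCTION AT AN EDGE IN THE MIDDLE OF AN `a-c-a` PATH (u–p–q–w coloured 2,1,2; p, q of degree 2)

Support file (seat `prim-ineq-gen-2` gen 25; `--supports stmt-CriticalPhenomena-4575`).  No `sorry`, no named facts; nothing is asserted about the crux.
Companion of `…SunflowerTriangleEdgeReduction` (same conclusion, same proof architecture, two external bits instead of one).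
Memo: run/shared/lean/prim/prim-ineq-gen-2/TWO-POINT-GEN25.md §7–§9 (edge type `({2},{2})`; exact certificate of kit j179539 type 5, gen25/edge_lp/).

SETTING.  Points `p ≠ q` outside the sub-cube `2^W'` and two further points `u ≠ w`; on `2^W'` the labels see `p` only through `u` (colour `2`), `q` only
through `w` (colour `2`) and the pair through its own colour `1`: for every `X ⊆ W'`,
  `lab (X+p) = X ∋ u ? lab X ∨ 2 : lab X`,  `lab (X+q) = X ∋ w ? lab X ∨ 2 : lab X`,  `lab (X+p+q) = (X ∋ u or X ∋ w) ? ⊤ : lab X ∨ 1`.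
THEOREM `Sunflower.two_ZP_insert_insert_ge_of_pathEdge` (this work):
  `4·(F.con p).ZP W' ∅ ∅ ∅ + (F.con q).ZP W' ∅ ∅ ∅ + 3·F.ZP (insert q W') ∅ ∅ ∅ ≤ 2·F.ZP (insert p (insert q W')) ∅ ∅ ∅`.
This is the 2-point structured certificate that exists for the `a-c-a` pattern but NOT for the rainbow pattern `2,1,3` (LP value −12/13, memo §7) —
the latter needs the 3-point windows of memo §8.

PROOF.  As in `…TriangleEdgeReduction`: block datum `((lab X, lab (X+p), lab (X+q), lab (X+p+q)), u ∈ X, w ∈ X)` ∈ 20 codes (`pCode`); realisability: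
each of `u`, `w` lies in at most one of the three blocks (`amo`); kernel `pKer` = `2·nineH − 4·conP − conQ − 3·(placements of q)` minus three
spectator-weighted antipodal-Gladkov rows (plain; `q`-contraction; `p`-contraction; weights `6`); `decide` in 20 chunks.
-/

namespace Summit.CriticalPhenomena.PercolationContinuityZ3.Theorems.SunflowerPartition

open Finset

/-! ## Finite data -/

/-- Block datum of a path-edge window: the four section labels and the bits `u ∈ X`, `w ∈ X`. [this work] -/
abbrev PData := BlockData × Bool × Bool

/-- "At most one of three bits". [this work] -/
def amo (a b c : Bool) : Bool := !(a && b) && !(a && c) && !(b && c)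

/-- The 20 realisable block data `((x, bu ? x∨2 : x, bw ? x∨2 : x, (bu ∨ bw) ? ⊤ : x∨1), bu, bw)`. [this work] -/
def pCode : Fin 20 → PData :=
  ![((0,0,0,1), false, false), ((0,0,2,4), false, true), ((0,2,0,4), true, false), ((0,2,2,4), true, true),
    ((1,1,1,1), false, false), ((1,1,4,4), false, true), ((1,4,1,4), true, false), ((1,4,4,4), true, true),
    ((2,2,2,4), false, false), ((2,2,2,4), false, true), ((2,2,2,4), true, false), ((2,2,2,4), true, true),
    ((3,3,3,4), false, false), ((3,3,4,4), false, true), ((3,4,3,4), true, false), ((3,4,4,4), true, true),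
    ((4,4,4,4), false, false), ((4,4,4,4), false, true), ((4,4,4,4), true, false), ((4,4,4,4), true, true)]

/-- Weight (doubled certificate) of the plain antipodal-Gladkov row behind a first block with datum `a`. [this work] -/
def pW0 (a : PData) : ℤ :=
  if a.1.1 = 0 then (if a.2.1 = true ∨ a.2.2 = true then 6 else 0)
  else if a.1.1 = 1 then (if a.2.1 = true ∧ a.2.2 = true then 6 else 0)
  else if a.1.1 = 3 then (if a.2.1 = a.2.2 then 6 else 0)
  else 6

/-- Weight of the `q`-contraction row `kk (lab (S+q)) (lab (T+q))`. [this work] -/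
def pWQ (a : PData) : ℤ := if (a.1.1 = 1 ∨ a.1.1 = 3) ∧ a.2.1 = true ∧ a.2.2 = false then 6 else 0

/-- Weight of the `p`-contraction row `kk (lab (S+p)) (lab (T+p))`. [this work] -/
def pWP (a : PData) : ℤ := if (a.1.1 = 1 ∨ a.1.1 = 3) ∧ a.2.1 = false ∧ a.2.2 = true then 6 else 0

/-- `pW0 ≥ 0`. [this work] -/
theorem pW0_nonneg (a : PData) : 0 ≤ pW0 a := by
  unfold pW0; split_ifs <;> norm_num

/-- `pWQ ≥ 0`. [this work] -/
theorem pWQ_nonneg (a : PData) : 0 ≤ pWQ a := by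
  unfold pWQ; split_ifs <;> norm_num

/-- `pWP ≥ 0`. [this work] -/
theorem pWP_nonneg (a : PData) : 0 ≤ pWP a := by
  unfold pWP; split_ifs <;> norm_num

/-- The kernel: twice the nine placements of `p,q`, minus `4·`(contract `p`, delete `q`), minus (contract `q`, delete `p`), minus `3·`(the three
placements of `q` with `p` deleted), minus the three weighted rows of the first block. [this work] -/
def pKer (a b c : PData) : ℤ :=
  2 * nineH a.1 b.1 c.1
    - (4 * s6H a.1.2.1 b.1.2.1 c.1.2.1 + s6H a.1.2.2.1 b.1.2.2.1 c.1.2.2.1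
        + 3 * (s6H a.1.2.2.1 b.1.1 c.1.1 + s6H a.1.1 b.1.2.2.1 c.1.1 + s6H a.1.1 b.1.1 c.1.2.2.1))
    - (pW0 a * kk b.1.1 c.1.1 + pWQ a * kk b.1.2.2.1 c.1.2.2.1 + pWP a * kk b.1.2.1 c.1.2.1)

/-- Kernel check on realisable code triples, first code `0`. [this work] -/
theorem pKer_symm_nonneg_0 : ∀ j k : Fin 20, amo (pCode 0).2.1 (pCode j).2.1 (pCode k).2.1 = true →
    amo (pCode 0).2.2 (pCode j).2.2 (pCode k).2.2 = true → 0 ≤ symm6Of pKer (pCode 0) (pCode j) (pCode k) := by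
  decide

/-- Kernel check on realisable code triples, first code `1`. [this work] -/
theorem pKer_symm_nonneg_1 : ∀ j k : Fin 20, amo (pCode 1).2.1 (pCode j).2.1 (pCode k).2.1 = true →
    amo (pCode 1).2.2 (pCode j).2.2 (pCode k).2.2 = true → 0 ≤ symm6Of pKer (pCode 1) (pCode j) (pCode k) := by
  decide

/-- Kernel check on realisable code triples, first code `2`. [this work] -/
theorem pKer_symm_nonneg_2 : ∀ j k : Fin 20, amo (pCode 2).2.1 (pCode j).2.1 (pCode k).2.1 = true →
    amo (pCode 2).2.2 (pCode j).2.2 (pCode k).2.2 = true → 0 ≤ symm6Of pKer (pCode 2) (pCode j) (pCode k) := by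
  decide

/-- Kernel check on realisable code triples, first code `3`. [this work] -/
theorem pKer_symm_nonneg_3 : ∀ j k : Fin 20, amo (pCode 3).2.1 (pCode j).2.1 (pCode k).2.1 = true →
    amo (pCode 3).2.2 (pCode j).2.2 (pCode k).2.2 = true → 0 ≤ symm6Of pKer (pCode 3) (pCode j) (pCode k) := by
  decide

/-- Kernel check on realisable code triples, first code `4`. [this work] -/
theorem pKer_symm_nonneg_4 : ∀ j k : Fin 20, amo (pCode 4).2.1 (pCode j).2.1 (pCode k).2.1 = true →
    amo (pCode 4).2.2 (pCode j).2.2 (pCode k).2.2 = true → 0 ≤ symm6Of pKer (pCode 4) (pCode j) (pCode k) := by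
  decide

/-- Kernel check on realisable code triples, first code `5`. [this work] -/
theorem pKer_symm_nonneg_5 : ∀ j k : Fin 20, amo (pCode 5).2.1 (pCode j).2.1 (pCode k).2.1 = true →
    amo (pCode 5).2.2 (pCode j).2.2 (pCode k).2.2 = true → 0 ≤ symm6Of pKer (pCode 5) (pCode j) (pCode k) := by
  decide

/-- Kernel check on realisable code triples, first code `6`. [this work] -/
theorem pKer_symm_nonneg_6 : ∀ j k : Fin 20, amo (pCode 6).2.1 (pCode j).2.1 (pCode k).2.1 = true →
    amo (pCode 6).2.2 (pCode j).2.2 (pCode k).2.2 = true → 0 ≤ symm6Of pKer (pCode 6) (pCode j) (pCode k) := by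
  decide

/-- Kernel check on realisable code triples, first code `7`. [this work] -/
theorem pKer_symm_nonneg_7 : ∀ j k : Fin 20, amo (pCode 7).2.1 (pCode j).2.1 (pCode k).2.1 = true →
    amo (pCode 7).2.2 (pCode j).2.2 (pCode k).2.2 = true → 0 ≤ symm6Of pKer (pCode 7) (pCode j) (pCode k) := by
  decide

/-- Kernel check on realisable code triples, first code `8`. [this work] -/
theorem pKer_symm_nonneg_8 : ∀ j k : Fin 20, amo (pCode 8).2.1 (pCode j).2.1 (pCode k).2.1 = true →
    amo (pCode 8).2.2 (pCode j).2.2 (pCode k).2.2 = true → 0 ≤ symm6Of pKer (pCode 8) (pCode j) (pCode k) := by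
  decide

/-- Kernel check on realisable code triples, first code `9`. [this work] -/
theorem pKer_symm_nonneg_9 : ∀ j k : Fin 20, amo (pCode 9).2.1 (pCode j).2.1 (pCode k).2.1 = true →
    amo (pCode 9).2.2 (pCode j).2.2 (pCode k).2.2 = true → 0 ≤ symm6Of pKer (pCode 9) (pCode j) (pCode k) := by
  decide

/-- Kernel check on realisable code triples, first code `10`. [this work] -/
theorem pKer_symm_nonneg_10 : ∀ j k : Fin 20, amo (pCode 10).2.1 (pCode j).2.1 (pCode k).2.1 = true →
    amo (pCode 10).2.2 (pCode j).2.2 (pCode k).2.2 = true → 0 ≤ symm6Of pKer (pCode 10) (pCode j) (pCode k) := by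
  decide

/-- Kernel check on realisable code triples, first code `11`. [this work] -/
theorem pKer_symm_nonneg_11 : ∀ j k : Fin 20, amo (pCode 11).2.1 (pCode j).2.1 (pCode k).2.1 = true →
    amo (pCode 11).2.2 (pCode j).2.2 (pCode k).2.2 = true → 0 ≤ symm6Of pKer (pCode 11) (pCode j) (pCode k) := by
  decide

/-- Kernel check on realisable code triples, first code `12`. [this work] -/
theorem pKer_symm_nonneg_12 : ∀ j k : Fin 20, amo (pCode 12).2.1 (pCode j).2.1 (pCode k).2.1 = true →
    amo (pCode 12).2.2 (pCode j).2.2 (pCode k).2.2 = true → 0 ≤ symm6Of pKer (pCode 12) (pCode j) (pCode k) := by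
  decide

/-- Kernel check on realisable code triples, first code `13`. [this work] -/
theorem pKer_symm_nonneg_13 : ∀ j k : Fin 20, amo (pCode 13).2.1 (pCode j).2.1 (pCode k).2.1 = true →
    amo (pCode 13).2.2 (pCode j).2.2 (pCode k).2.2 = true → 0 ≤ symm6Of pKer (pCode 13) (pCode j) (pCode k) := by
  decide

/-- Kernel check on realisable code triples, first code `14`. [this work] -/
theorem pKer_symm_nonneg_14 : ∀ j k : Fin 20, amo (pCode 14).2.1 (pCode j).2.1 (pCode k).2.1 = true →
    amo (pCode 14).2.2 (pCode j).2.2 (pCode k).2.2 = true → 0 ≤ symm6Of pKer (pCode 14) (pCode j) (pCode k) := by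
  decide

/-- Kernel check on realisable code triples, first code `15`. [this work] -/
theorem pKer_symm_nonneg_15 : ∀ j k : Fin 20, amo (pCode 15).2.1 (pCode j).2.1 (pCode k).2.1 = true →
    amo (pCode 15).2.2 (pCode j).2.2 (pCode k).2.2 = true → 0 ≤ symm6Of pKer (pCode 15) (pCode j) (pCode k) := by
  decide

/-- Kernel check on realisable code triples, first code `16`. [this work] -/
theorem pKer_symm_nonneg_16 : ∀ j k : Fin 20, amo (pCode 16).2.1 (pCode j).2.1 (pCode k).2.1 = true →
    amo (pCode 16).2.2 (pCode j).2.2 (pCode k).2.2 = true → 0 ≤ symm6Of pKer (pCode 16) (pCode j) (pCode k) := by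
  decide

/-- Kernel check on realisable code triples, first code `17`. [this work] -/
theorem pKer_symm_nonneg_17 : ∀ j k : Fin 20, amo (pCode 17).2.1 (pCode j).2.1 (pCode k).2.1 = true →
    amo (pCode 17).2.2 (pCode j).2.2 (pCode k).2.2 = true → 0 ≤ symm6Of pKer (pCode 17) (pCode j) (pCode k) := by
  decide

/-- Kernel check on realisable code triples, first code `18`. [this work] -/
theorem pKer_symm_nonneg_18 : ∀ j k : Fin 20, amo (pCode 18).2.1 (pCode j).2.1 (pCode k).2.1 = true →
    amo (pCode 18).2.2 (pCode j).2.2 (pCode k).2.2 = true → 0 ≤ symm6Of pKer (pCode 18) (pCode j) (pCode k) := by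
  decide

/-- Kernel check on realisable code triples, first code `19`. [this work] -/
theorem pKer_symm_nonneg_19 : ∀ j k : Fin 20, amo (pCode 19).2.1 (pCode j).2.1 (pCode k).2.1 = true →
    amo (pCode 19).2.2 (pCode j).2.2 (pCode k).2.2 = true → 0 ≤ symm6Of pKer (pCode 19) (pCode j) (pCode k) := by
  decide

/-- **Kernel check on all realisable code triples.** [this work] -/
theorem pKer_symm_nonneg : ∀ i j k : Fin 20, amo (pCode i).2.1 (pCode j).2.1 (pCode k).2.1 = true →
    amo (pCode i).2.2 (pCode j).2.2 (pCode k).2.2 = true → 0 ≤ symm6Of pKer (pCode i) (pCode j) (pCode k) := by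
  intro i
  fin_cases i
  · exact pKer_symm_nonneg_0
  · exact pKer_symm_nonneg_1
  · exact pKer_symm_nonneg_2
  · exact pKer_symm_nonneg_3
  · exact pKer_symm_nonneg_4
  · exact pKer_symm_nonneg_5
  · exact pKer_symm_nonneg_6
  · exact pKer_symm_nonneg_7
  · exact pKer_symm_nonneg_8
  · exact pKer_symm_nonneg_9
  · exact pKer_symm_nonneg_10
  · exact pKer_symm_nonneg_11
  · exact pKer_symm_nonneg_12
  · exact pKer_symm_nonneg_13
  · exact pKer_symm_nonneg_14
  · exact pKer_symm_nonneg_15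
  · exact pKer_symm_nonneg_16
  · exact pKer_symm_nonneg_17
  · exact pKer_symm_nonneg_18
  · exact pKer_symm_nonneg_19

/-- The data forced by the local hypotheses are codes. [this work] -/
theorem exists_pCode : ∀ (x : Fin 5) (bu bw : Bool), ∃ i : Fin 20,
    pCode i = ((x, (if bu = true then jn x 2 else x), (if bw = true then jn x 2 else x), (if (bu || bw) = true then 4 else jn x 1)), bu, bw) := by
  decide

/-- Three pairwise-disjoint blocks contain a point at most once. [this work] -/
theorem amo_of_disjoint {α : Type*} [DecidableEq α] {X S T : Finset α} (h1 : Disjoint X S) (h2 : Disjoint X T) (h3 : Disjoint S T) (v : α) :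
    amo (decide (v ∈ X)) (decide (v ∈ S)) (decide (v ∈ T)) = true := by
  by_cases hX : v ∈ X
  · have hS : v ∉ S := fun h => disjoint_left.1 h1 hX h
    have hT : v ∉ T := fun h => disjoint_left.1 h2 hX h
    simp [amo, hX, hS, hT]
  · by_cases hS : v ∈ S
    · have hT : v ∉ T := fun h => disjoint_left.1 h3 hS h
      simp [amo, hX, hS, hT]
    · simp [amo, hX, hS]

variable {α : Type*} [Fintype α] [DecidableEq α]

namespace Sunflower

variable (F : Sunflower α)

/-- **★-reduction at the middle edge of an `a-c-a` path** (structured two-point certificate): if on the sub-cube `2^W'` (`p ≠ q`, `p, q ∉ W'`)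
`lab (X+p) = (u ∈ X ? lab X ∨ 2 : lab X)`, `lab (X+q) = (w ∈ X ? lab X ∨ 2 : lab X)`, `lab (X+p+q) = (u ∈ X ∨ w ∈ X ? ⊤ : lab X ∨ 1)` for all
`X ⊆ W'`, then `4·(F.con p).ZP W' + (F.con q).ZP W' + 3·F.ZP (W'+q) ≤ 2·F.ZP (W'+p+q)`. [this work] -/
theorem two_ZP_insert_insert_ge_of_pathEdge (W' : Finset α) {p q u w : α} (hpq : p ≠ q) (hp : p ∉ W') (hq : q ∉ W')
    (hP : ∀ X ⊆ W', F.lab (insert p X) = if u ∈ X then jn (F.lab X) 2 else F.lab X)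
    (hQ : ∀ X ⊆ W', F.lab (insert q X) = if w ∈ X then jn (F.lab X) 2 else F.lab X)
    (hPQ : ∀ X ⊆ W', F.lab (insert p (insert q X)) = if (u ∈ X ∨ w ∈ X) then 4 else jn (F.lab X) 1) :
    4 * (F.con p).ZP W' ∅ ∅ ∅ + (F.con q).ZP W' ∅ ∅ ∅ + 3 * F.ZP (insert q W') ∅ ∅ ∅
      ≤ 2 * F.ZP (insert p (insert q W')) ∅ ∅ ∅ := by
  have hpW : p ∉ insert q W' := fun hh => by
    rcases mem_insert.1 hh with hh | hh
    · exact hpq hh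
    · exact hp hh
  set G : Finset α → Finset α → Finset α → ℤ := fun X S T => s6H (F.lab X) (F.lab S) (F.lab T) with hG
  set L : Finset α → PData := fun X => (F.blockData p q X, decide (u ∈ X), decide (w ∈ X)) with hL
  have hZ2 : F.ZP (insert p (insert q W')) ∅ ∅ ∅ = nested (insert p (insert q W')) G := F.ZP_empty_eq_nested _
  have hZ1 : F.ZP (insert q W') ∅ ∅ ∅ = nested (insert q W') G := F.ZP_empty_eq_nested _
  have hCp := F.con_ZP_eq_nested W' p
  have hCq := F.con_ZP_eq_nested W' q
  have hsplit : 2 * nested (insert p (insert q W')) G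
      - (4 * nested W' (fun X S T => s6H (F.lab (insert p X)) (F.lab (insert p S)) (F.lab (insert p T)))
          + nested W' (fun X S T => s6H (F.lab (insert q X)) (F.lab (insert q S)) (F.lab (insert q T)))
          + 3 * nested (insert q W') G)
      = nested W' (fun X S T => pKer (L X) (L S) (L T))
        + (nested W' (fun X S T => pW0 (L X) * kk (F.lab S) (F.lab T))
          + nested W' (fun X S T => pWQ (L X) * kk (F.lab (insert q S)) (F.lab (insert q T)))
          + nested W' (fun X S T => pWP (L X) * kk (F.lab (insert p S)) (F.lab (insert p T)))) := by
    rw [nested_insert_split _ p hpW, nested_insert_split _ q hq, nested_insert_split _ q hq, nested_insert_split _ q hq,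
      nested_insert_split _ q hq]
    unfold nested
    simp only [hG, hL, blockData, pKer, nineH, mul_add, sum_add_distrib, sum_sub_distrib, mul_sum]
    ring
  have hker : 0 ≤ nested W' (fun X S T => pKer (L X) (L S) (L T)) := by
    have h6 := six_mul_nested_eq_symm6Of W' L pKer
    have hpos : 0 ≤ nested W' (fun X S T => symm6Of pKer (L X) (L S) (L T)) := by
      refine nested_nonneg_of_forall W' _ fun X hX S hS => ?_
      have hT : (W' \ X) \ S ⊆ W' := sdiff_subset.trans sdiff_subset
      have hS' : S ⊆ W' := hS.trans sdiff_subset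
      have hcode : ∀ Y ⊆ W', ∃ i : Fin 20, pCode i = L Y := by
        intro Y hY
        obtain ⟨i, hi⟩ := exists_pCode (F.lab Y) (decide (u ∈ Y)) (decide (w ∈ Y))
        refine ⟨i, ?_⟩
        rw [hi, hL]
        have e1 := hP Y hY
        have e2 := hQ Y hY
        have e3 := hPQ Y hY
        by_cases hu : u ∈ Y <;> by_cases hw : w ∈ Y <;> simp [blockData, e1, e2, e3, hu, hw]
      obtain ⟨a, ha⟩ := hcode X hX
      obtain ⟨b, hb⟩ := hcode S hS'
      obtain ⟨c, hc⟩ := hcode ((W' \ X) \ S) hT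
      have d1 : Disjoint X S := disjoint_of_subset_right hS disjoint_sdiff
      have d2 : Disjoint X ((W' \ X) \ S) := disjoint_of_subset_right sdiff_subset disjoint_sdiff
      have d3 : Disjoint S ((W' \ X) \ S) := disjoint_sdiff
      have ru := amo_of_disjoint d1 d2 d3 u
      have rw_ := amo_of_disjoint d1 d2 d3 w
      have eu : ∀ Y, (L Y).2.1 = decide (u ∈ Y) := fun Y => rfl
      have ew : ∀ Y, (L Y).2.2 = decide (w ∈ Y) := fun Y => rfl
      rw [← ha, ← hb, ← hc]
      refine pKer_symm_nonneg a b c ?_ ?_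
      · rw [ha, hb, hc, eu, eu, eu]; exact ru
      · rw [ha, hb, hc, ew, ew, ew]; exact rw_
    linarith
  have hrow0 : 0 ≤ nested W' (fun X S T => pW0 (L X) * kk (F.lab S) (F.lab T)) :=
    F.nested_weight_mul_kk_nonneg W' (fun X => pW0 (L X)) fun X => pW0_nonneg _
  have hrowQ : 0 ≤ nested W' (fun X S T => pWQ (L X) * kk (F.lab (insert q S)) (F.lab (insert q T))) :=
    F.nested_weight_mul_kk_insert_nonneg W' q (fun X => pWQ (L X)) fun X => pWQ_nonneg _
  have hrowP : 0 ≤ nested W' (fun X S T => pWP (L X) * kk (F.lab (insert p S)) (F.lab (insert p T))) :=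
    F.nested_weight_mul_kk_insert_nonneg W' p (fun X => pWP (L X)) fun X => pWP_nonneg _
  rw [hZ2, hZ1, hCp, hCq]
  linarith

end Sunflower

end Summit.CriticalPhenomena.PercolationContinuityZ3.Theorems.SunflowerPartition
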